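import Summits.PneNP.PneNP.Theorems.SzkEntropyPeaThreeNotInPCoreDefs
import Literature.Computability.Complexity.GaussRankFP

/-!
# Route SzkEntropy, crux `PeaThreeNotInP` (stmt-PneNP-10776), line `SketchIdeator3`, step S7:
# the untyped core map `coreMapN` is polynomial time on codes (`stub_coreMapFP`)

Step S7 Karp-reduces FULL 3-Tensor Isomorphism over `F₂` to the concise-promise version by passing
to concise cores (`…CoreDefs.lean`, §3).  The untyped Karp map `coreMapN` is an explicit functional
program over lists of numerals: `denseRows` (the dense rows of the first flattening of a support
tensor), `sweep` (the Gauss–Jordan list sweep `GaussRank.lrun` over `ZMod 2`), `pivRows` (the flagged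
rows), `readRow`/`passN` (the pivot rows read back as a rotated support list), `coreN` (three
passes), `clampN` (drop out-of-range triples) and the final case split against the fixed pair
`fixedNoN`.  We prove, layer by layer, that each of these list functions is computed on codes by a
polynomial-time string function in the typed algebra `CodeFP` (`map`, `filter`, `mem`, `mapIdx`,
`rawZip`, `flatten`, `ulength`, the column loop `GaussRank.codeFP_lrun` at `p = 2`, `eq`, `ite`), and
conclude `stub_coreMapFP : CodeFP tiE tiE coreMapN` (the two support lists of `tiE` carry a unary
length header, converted by `rawOfList`/`listOfRaw`).  No size estimate is written: the combinators
carry the polynomial bounds.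

Sources: S. Arora, B. Barak, *Computational Complexity: A Modern Approach*, CUP 2009, §1.3
(closure of polynomial time under composition and polynomially bounded loops); J. von zur Gathen,
J. Gerhard, *Modern Computer Algebra*, 3rd ed., CUP 2013, §12.1 (Gaussian elimination over finite
fields in polynomial time); J. A. Grochow, Y. Qiao, SIAM J. Comput. 52 (2023), §2.
-/

noncomputable section

open Matrix
open scoped Kronecker
open _root_.Computability
open Literature.Computability.Complexity

namespace Summit.PneNP.PneNP.Cruxes.PeaThreeNotInP.TensorIsoLine

set_option linter.dupNamespace false -- `Summit.PneNP.PneNP.…`: summit = sub-problem name (D-0017 single-conjunct layout)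

open CodeFP

/-- The entry of the dense rows on codes: argument `((L, i), jk)`, value `1` iff `(i, jk) ∈ L`
(membership through equality of the injective triple codes). [AroraBarak2009, §1.3] -/
theorem cfp_denseEntry :
    CodeFP (pairE (pairE (rawE tripleE) natE) (pairE natE natE)) (GaussRank.zmodE 2)
      (fun t => if (t.1.2, t.2) ∈ t.1.1 then (1 : ZMod 2) else 0) := by
  have hmem : CodeFP (pairE (pairE (rawE tripleE) natE) (pairE natE natE)) bitE
      (fun t => decide ((t.1.2, t.2) ∈ t.1.1)) :=
    (mem tripleE_injective).comp (((fst _ _).snd'.pair (snd _ _)).pair (fst _ _).fst')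
  exact (hmem.ite (const _ (1 : ZMod 2)) (const _ (0 : ZMod 2))).congr fun t => by
    simp only [decide_eq_true_eq]

/-- **The dense rows on codes**: `L ↦ denseRows L` (two nested `map`s over the listed row and
column labels). [AroraBarak2009, §1.3] -/
theorem cfp_denseRows : CodeFP (rawE tripleE) (rawE (GaussRank.rowE 2)) denseRows := by
  have hrow : CodeFP (pairE (rawE tripleE) natE) (GaussRank.rowE 2)
      (fun c => (c.1.map Prod.snd).map fun jk => if (c.2, jk) ∈ c.1 then (1 : ZMod 2) else 0) :=
    ((CodeFP.map cfp_denseEntry).comp ((CodeFP.id _).pair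
      ((map₀ (snd natE (pairE natE natE))).comp (fst _ _)))).congr fun _ => rfl
  exact ((CodeFP.map hrow).comp ((CodeFP.id _).pair (map₀ (fst natE (pairE natE natE))))).congr
    fun _ => rfl

/-- **The Gauss–Jordan sweep on codes**: `L ↦ sweep L`, by the column loop
`GaussRank.codeFP_lrun` at `p = 2` (row length `|L|` in unary by `ulength`).
[von zur Gathen–Gerhard 2013, §12.1; AroraBarak2009, §1.3] -/
theorem cfp_sweep : CodeFP (rawE tripleE) (GaussRank.stE 2) sweep := by
  have hlen : CodeFP (rawE tripleE) unE (fun L => (L.map Prod.snd).length) :=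
    (ulength (pairE natE natE)).comp (map₀ (snd natE (pairE natE natE)))
  exact ((GaussRank.codeFP_lrun (p := 2)).comp (hlen.pair cfp_denseRows)).congr fun _ => rfl

/-- **The pivot rows on codes**: `L ↦ pivRows L` (filter the flags, drop them).
[AroraBarak2009, §1.3] -/
theorem cfp_pivRows : CodeFP (rawE tripleE) (rawE (GaussRank.rowE 2)) pivRows := by
  have hflag : CodeFP (pairE (rawE tripleE) (GaussRank.brE 2)) bitE (fun t => t.2.1) :=
    (snd _ _).fst'
  exact ((map₀ (snd bitE (GaussRank.rowE 2))).comp ((CodeFP.filter hflag).comp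
    ((CodeFP.id _).pair cfp_sweep))).congr fun _ => rfl

/-- **One pivot row read back on codes**: argument `(cols, i', row)`, value `readRow cols i' row`
(`rawZip`, a `filter` on the test `· = 1` through equality of residue codes, a `map` with the
context `i'`). [AroraBarak2009, §1.3] -/
theorem cfp_readRow :
    CodeFP (pairE (rawE (pairE natE natE)) (pairE natE (GaussRank.rowE 2))) (rawE tripleE)
      (fun t => readRow t.1 t.2.1 t.2.2) := by
  have hzip : CodeFP (pairE (rawE (pairE natE natE)) (pairE natE (GaussRank.rowE 2)))
      (rawE (pairE (pairE natE natE) (GaussRank.zmodE 2))) (fun t => t.1.zip t.2.2) :=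
    (rawZip (pairE natE natE) (GaussRank.zmodE 2)).comp ((fst _ _).pair (snd _ _).snd')
  have hone : CodeFP (pairE (pairE (rawE (pairE natE natE)) (pairE natE (GaussRank.rowE 2)))
      (pairE (pairE natE natE) (GaussRank.zmodE 2))) bitE (fun q => decide (q.2.2 = 1)) :=
    (CodeFP.eq (GaussRank.zmodE_injective (p := 2))).comp
      ((snd _ _).snd'.pair (const _ (1 : ZMod 2)))
  have hfilt : CodeFP (pairE (rawE (pairE natE natE)) (pairE natE (GaussRank.rowE 2)))
      (rawE (pairE (pairE natE natE) (GaussRank.zmodE 2)))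
      (fun t => (t.1.zip t.2.2).filter fun e => decide (e.2 = 1)) :=
    ((CodeFP.filter hone).comp ((CodeFP.id _).pair hzip)).congr fun _ => rfl
  have hg : CodeFP (pairE natE (pairE (pairE natE natE) (GaussRank.zmodE 2))) tripleE
      (fun q => (q.2.1.1, q.2.1.2, q.1)) :=
    (snd _ _).fst'.fst'.pair ((snd _ _).fst'.snd'.pair (fst _ _))
  exact ((CodeFP.map hg).comp ((snd _ _).fst'.pair hfilt)).congr fun _ => rfl

/-- **One pass on codes**: `L ↦ passN L` (`natLength`, `mapIdx` of `readRow` with the column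
labels as context, `flatten`). [AroraBarak2009, §1.3] -/
theorem cfp_passN : CodeFP (rawE tripleE) (pairE natE (rawE tripleE)) passN := by
  have hcols : CodeFP (rawE tripleE) (rawE (pairE natE natE)) (fun L => L.map Prod.snd) :=
    map₀ (snd natE (pairE natE natE))
  exact (((natLength (GaussRank.rowE 2)).comp cfp_pivRows).pair ((CodeFP.flatten tripleE).comp
    ((CodeFP.mapIdx cfp_readRow).comp (hcols.pair cfp_pivRows)))).congr fun _ => rfl

/-- **Three passes on codes**: `L ↦ coreN L`. [AroraBarak2009, §1.3] -/
theorem cfp_coreN : CodeFP (rawE tripleE) (pairE tripleE (rawE tripleE)) coreN := by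
  have h1 : CodeFP (rawE tripleE) (pairE natE (rawE tripleE)) passN := cfp_passN
  have h2 : CodeFP (rawE tripleE) (pairE natE (rawE tripleE)) (fun L => passN (passN L).2) :=
    cfp_passN.comp h1.snd'
  have h3 : CodeFP (rawE tripleE) (pairE natE (rawE tripleE))
      (fun L => passN (passN (passN L).2).2) := cfp_passN.comp h2.snd'
  exact ((h1.fst'.pair (h2.fst'.pair h3.fst')).pair h3.snd').congr fun _ => rfl

/-- The in-range test on codes: argument `(q, p)`, value `inRangeN q p`. [AroraBarak2009, §1.3] -/
theorem cfp_inRangeN : CodeFP (pairE tripleE tripleE) bitE (fun t => inRangeN t.1 t.2) :=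
  ((natLt.comp ((snd _ _).fst'.pair (fst _ _).fst')).and
    ((natLt.comp ((snd _ _).snd'.fst'.pair (fst _ _).snd'.fst')).and
      (natLt.comp ((snd _ _).snd'.snd'.pair (fst _ _).snd'.snd')))).congr fun _ => rfl

/-- **Clamping on codes**: `y ↦ clampN y` on untyped instances with RAW support lists (two
`filter`s with the formats as context). [AroraBarak2009, §1.3] -/
theorem cfp_clampN :
    CodeFP (pairE natE (pairE natE (pairE natE (pairE (rawE tripleE) (rawE tripleE)))))
      (pairE natE (pairE natE (pairE natE (pairE (rawE tripleE) (rawE tripleE))))) clampN := by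
  have hq : CodeFP (pairE natE (pairE natE (pairE natE (pairE (rawE tripleE) (rawE tripleE)))))
      tripleE (fun y => (y.1, y.2.1, y.2.2.1)) :=
    (fst _ _).pair ((snd _ _).fst'.pair (snd _ _).snd'.fst')
  have hS := (CodeFP.filter cfp_inRangeN).comp (hq.pair (snd _ _).snd'.snd'.fst')
  have hT := (CodeFP.filter cfp_inRangeN).comp (hq.pair (snd _ _).snd'.snd'.snd')
  exact ((fst _ _).pair ((snd _ _).fst'.pair ((snd _ _).snd'.fst'.pair (hS.pair hT)))).congr
    fun _ => rfl

/-- **The untyped Karp map on codes, raw output**: `x ↦ coreMapN x` from the headed code `tiE` to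
the code with RAW support lists (the case split on equal core formats is an `ite` on the equality
test of the injective triple codes). [GrochowQiao2023, §2; AroraBarak2009, §1.3] -/
theorem cfp_coreMapN_raw :
    CodeFP tiE (pairE natE (pairE natE (pairE natE (pairE (rawE tripleE) (rawE tripleE)))))
      coreMapN := by
  have hLS : CodeFP tiE (rawE tripleE) (fun x => x.2.2.2.1) :=
    (rawOfList _).comp (snd _ _).snd'.snd'.fst'
  have hLT : CodeFP tiE (rawE tripleE) (fun x => x.2.2.2.2) :=
    (rawOfList _).comp (snd _ _).snd'.snd'.snd'
  have hcS : CodeFP tiE (pairE tripleE (rawE tripleE)) (fun x => coreN x.2.2.2.1) :=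
    cfp_coreN.comp hLS
  have hcT : CodeFP tiE (pairE tripleE (rawE tripleE)) (fun x => coreN x.2.2.2.2) :=
    cfp_coreN.comp hLT
  have heq : CodeFP tiE bitE (fun x => decide ((coreN x.2.2.2.1).1 = (coreN x.2.2.2.2).1)) :=
    (CodeFP.eq tripleE_injective).comp (hcS.fst'.pair hcT.fst')
  have hyes : CodeFP tiE (pairE natE (pairE natE (pairE natE (pairE (rawE tripleE) (rawE tripleE)))))
      (fun x => ((coreN x.2.2.2.1).1.1, (coreN x.2.2.2.1).1.2.1, (coreN x.2.2.2.1).1.2.2,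
        (coreN x.2.2.2.1).2, (coreN x.2.2.2.2).2)) :=
    hcS.fst'.fst'.pair (hcS.fst'.snd'.fst'.pair (hcS.fst'.snd'.snd'.pair (hcS.snd'.pair hcT.snd')))
  exact (cfp_clampN.comp (heq.ite hyes (const _ fixedNoN))).congr fun x => by
    simp only [coreMapN, decide_eq_true_eq]

/-- **stub_coreMapFP** (W1): the untyped Karp map `coreMapN` of S7 is computed on codes by a
polynomial-time string function (`CodeFP`: `map`/`filter`/`mem`/`mapIdx`/`rawZip`/`flatten`/`ulength`,
the Gauss–Jordan column loop `GaussRank.codeFP_lrun` at `p = 2`, `eq`, `ite`; the headed support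
lists of `tiE` are recomputed by `listOfRaw`). [AroraBarak2009, §1.3] -/
theorem stub_coreMapFP : CodeFP tiE tiE coreMapN := by
  have hout : CodeFP (pairE natE (pairE natE (pairE natE (pairE (rawE tripleE) (rawE tripleE)))))
      tiE id :=
    ((fst _ _).pair ((snd _ _).fst'.pair ((snd _ _).snd'.fst'.pair
      (((listOfRaw tripleE).comp (snd _ _).snd'.snd'.fst').pair
        ((listOfRaw tripleE).comp (snd _ _).snd'.snd'.snd'))))).congr fun _ => rfl
  exact (hout.comp cfp_coreMapN_raw).congr fun _ => rfl

end Summit.PneNP.PneNP.Cruxes.PeaThreeNotInP.TensorIsoLine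

end
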